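import Mathlib.RingTheory.GradedAlgebra.Homogeneous.Ideal
import Mathlib.RingTheory.GradedAlgebra.Homogeneous.Maps
import Mathlib.RingTheory.GradedAlgebra.RingHom
import Mathlib.RingTheory.Ideal.Quotient.Operations
import HarnessLib

/-!
# The grading of a quotient `A ⧸ I` by a homogeneous ideal

Topic: `Literature/RingTheory/GradedAlgebra`. For a graded `R`-algebra `A = ⨁ᵢ 𝒜 i` (Mathlib
`GradedAlgebra 𝒜`, `𝒜 : ι → Submodule R A`) and an ideal `I ≤ A`, the images
`(A ⧸ I)ᵢ := 𝒜 i · (A ⧸ I)` of the graded pieces under the quotient map (`quotGrading 𝒜 I`) always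
form a graded monoid of submodules spanning `A ⧸ I`; when `I` is HOMOGENEOUS (generated by
homogeneous elements, Mathlib `Ideal.IsHomogeneous 𝒜 I` / `I : HomogeneousIdeal 𝒜`) they are
independent, so `A ⧸ I = ⨁ᵢ (A ⧸ I)ᵢ` is again a graded `R`-algebra and the quotient map is a
graded ring homomorphism (standard: Bruns–Herzog, *Cohen–Macaulay rings*, §1.5 — for a graded ideal
`I` the quotient `R/I` is graded by `(R/I)ᵢ = Rᵢ/Iᵢ`; Bourbaki, *Algèbre* II §11). Mathlib (tag of
this tree) has homogeneous ideals and `Proj` but not this quotient grading; it is the input of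
`Proj (A ⧸ I)` — closed subschemes of `Proj A` such as Stanley–Reisner schemes
(`Literature/AlgebraicGeometry/StanleyReisner`).

* `quotGrading 𝒜 I i = (𝒜 i).map (A → A ⧸ I)`; `quotGrading.gradedMonoid` (any ideal);
  `iSup_quotGrading_eq_top` (any ideal); `iSupIndep_quotGrading`, `isInternal_quotGrading`
  (`I` homogeneous);
* `quotGrading.gradedAlgebra I : GradedAlgebra (quotGrading 𝒜 I.toIdeal)` for
  `I : HomogeneousIdeal 𝒜` (noncomputable, through `DirectSum.IsInternal.gradedAlgebra`);
* `quotGradedHom 𝒜 I : 𝒜 →+*ᵍ quotGrading 𝒜 I`, the quotient map as a graded ring homomorphism,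
  `decompose_quotGrading_mk` (taking homogeneous components commutes with the quotient map) and
  `irrelevant_quotGrading_le_map` (the irrelevant ideal of `A ⧸ I` is the image of that of `A` —
  the hypothesis of Mathlib's `AlgebraicGeometry.Proj.map`).

Everything is proved; no named facts.

## References

* W. Bruns, J. Herzog, *Cohen–Macaulay rings*, rev. ed. (1998), §1.5 (graded rings and modules;
  quotients by graded ideals). [BrunsHerzog1998]
-/

open DirectSum

namespace Literature.RingTheory.GradedAlgebra

variable {ι R A : Type*} [CommRing R] [CommRing A] [Algebra R A]
variable (𝒜 : ι → Submodule R A) (I : Ideal A)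

/-- The **quotient grading**: the `i`-th graded piece of `A ⧸ I` is the image of `𝒜 i` under the
quotient map, `(A ⧸ I)ᵢ = (𝒜 i + I) / I`. Defined for every ideal; it is a direct-sum decomposition
exactly when `I` is homogeneous (`isInternal_quotGrading`). [folklore] -/
def quotGrading (i : ι) : Submodule R (A ⧸ I) :=
  (𝒜 i).map (Ideal.Quotient.mkₐ R I).toLinearMap

variable {𝒜 I} in
/-- Membership in a graded piece of the quotient: `x ∈ (A ⧸ I)ᵢ ↔ x = ā` for some `a ∈ 𝒜 i`.
[folklore] -/
theorem mem_quotGrading_iff {i : ι} {x : A ⧸ I} :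
    x ∈ quotGrading 𝒜 I i ↔ ∃ a ∈ 𝒜 i, Ideal.Quotient.mk I a = x :=
  Submodule.mem_map

variable {𝒜 I} in
/-- The class of a homogeneous element is homogeneous of the same degree. [folklore] -/
theorem mk_mem_quotGrading {i : ι} {a : A} (ha : a ∈ 𝒜 i) :
    Ideal.Quotient.mk I a ∈ quotGrading 𝒜 I i :=
  mem_quotGrading_iff.2 ⟨a, ha, rfl⟩

/-- The quotient pieces form a graded monoid (`1 ∈ (A⧸I)₀`, `(A⧸I)ᵢ (A⧸I)ⱼ ⊆ (A⧸I)ᵢ₊ⱼ`), for any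
ideal `I`. [folklore] -/
instance quotGrading.gradedMonoid [AddMonoid ι] [SetLike.GradedMonoid 𝒜] :
    SetLike.GradedMonoid (quotGrading 𝒜 I) where
  one_mem := mem_quotGrading_iff.2 ⟨1, SetLike.one_mem_graded 𝒜, rfl⟩
  mul_mem := by
    rintro i j _ _ hx hy
    obtain ⟨a, ha, rfl⟩ := mem_quotGrading_iff.1 hx
    obtain ⟨b, hb, rfl⟩ := mem_quotGrading_iff.1 hy
    exact mem_quotGrading_iff.2 ⟨a * b, SetLike.mul_mem_graded ha hb, rfl⟩

section Decomposition

variable [DecidableEq ι] [AddMonoid ι] [GradedAlgebra 𝒜]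

/-- The quotient pieces span `A ⧸ I` (for any ideal `I`): `⨆ᵢ (A⧸I)ᵢ = ⊤`. [folklore] -/
theorem iSup_quotGrading_eq_top : ⨆ i, quotGrading 𝒜 I i = ⊤ := by
  simp only [quotGrading, ← Submodule.map_iSup,
    (Decomposition.isInternal 𝒜).submodule_iSup_eq_top, Submodule.map_top, LinearMap.range_eq_top]
  exact Ideal.Quotient.mkₐ_surjective R I

variable {𝒜} in
/-- An element of `⨆_{j ≠ i} 𝒜 j` has zero `i`-th homogeneous component. [folklore] -/
theorem decompose_apply_eq_zero_of_mem_iSup_ne {i : ι} {c : A} (hc : c ∈ ⨆ j ≠ i, 𝒜 j) :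
    (decompose 𝒜 c i : A) = 0 := by
  induction hc using Submodule.iSup_induction' with
  | mem j x hx =>
    by_cases hji : j = i
    · subst hji
      rw [iSup_neg (fun h => h rfl), Submodule.mem_bot] at hx
      simp [hx]
    · rw [iSup_pos hji] at hx
      exact decompose_of_mem_ne 𝒜 hx hji
  | zero => simp
  | add x y _ _ hx hy => simp [decompose_add, hx, hy]

/-- For a HOMOGENEOUS ideal the quotient pieces are independent: if `ā ∈ (A⧸I)ᵢ` also lies in
`Σ_{j ≠ i} (A⧸I)ⱼ`, write `a - c ∈ I` with `a ∈ 𝒜 i`, `c ∈ ⨆_{j≠i} 𝒜 j`; the `i`-th component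
`a` of `a - c` lies in `I`, so `ā = 0`. [folklore] -/
theorem iSupIndep_quotGrading (hI : I.IsHomogeneous 𝒜) : iSupIndep (quotGrading 𝒜 I) := by
  rw [iSupIndep_def]
  intro i
  rw [Submodule.disjoint_def]
  intro x hx hx'
  obtain ⟨a, ha, rfl⟩ := mem_quotGrading_iff.1 hx
  have hmap : (⨆ j ≠ i, quotGrading 𝒜 I j) =
      (⨆ j ≠ i, 𝒜 j).map (Ideal.Quotient.mkₐ R I).toLinearMap := by
    simp only [quotGrading, Submodule.map_iSup]
  rw [hmap] at hx'
  obtain ⟨c, hc, hca⟩ := Submodule.mem_map.1 hx'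
  have hsub : a - c ∈ I := by
    rw [← Ideal.Quotient.eq, ← Ideal.Quotient.mkₐ_eq_mk R]
    exact hca.symm
  have hcomp := hI.mem_iff.1 hsub i
  rw [decompose_sub, DirectSum.sub_apply, Submodule.coe_sub,
    decompose_apply_eq_zero_of_mem_iSup_ne hc, sub_zero, decompose_of_mem_same 𝒜 ha] at hcomp
  exact (Ideal.Quotient.eq_zero_iff_mem).2 hcomp

/-- For a homogeneous ideal, `A ⧸ I` is the internal direct sum of the quotient pieces.
[folklore] -/
theorem isInternal_quotGrading (hI : I.IsHomogeneous 𝒜) : DirectSum.IsInternal (quotGrading 𝒜 I) :=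
  (DirectSum.isInternal_submodule_iff_iSupIndep_and_iSup_eq_top _).2
    ⟨iSupIndep_quotGrading 𝒜 I hI, iSup_quotGrading_eq_top 𝒜 I⟩

/-- **The quotient of a graded algebra by a homogeneous ideal is a graded algebra**, graded by the
images of the graded pieces (Bruns–Herzog §1.5). Noncomputable: the decomposition is obtained from
`DirectSum.IsInternal`. [folklore] -/
noncomputable instance quotGrading.gradedAlgebra (I : HomogeneousIdeal 𝒜) :
    GradedAlgebra (quotGrading 𝒜 I.toIdeal) :=
  (isInternal_quotGrading 𝒜 I.toIdeal I.isHomogeneous).gradedAlgebra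

end Decomposition

/-- The quotient map `A → A ⧸ I` as a GRADED ring homomorphism `𝒜 →+*ᵍ quotGrading 𝒜 I` (it maps
`𝒜 i` into `(A⧸I)ᵢ` by definition). [folklore] -/
def quotGradedHom : 𝒜 →+*ᵍ quotGrading 𝒜 I where
  __ := Ideal.Quotient.mk I
  map_mem := fun hx => mk_mem_quotGrading hx

/-- Unfolding: the graded quotient map is the quotient map. [folklore] -/
@[simp]
theorem quotGradedHom_apply (a : A) : quotGradedHom 𝒜 I a = Ideal.Quotient.mk I a := rfl

/-- The graded quotient map is surjective. [folklore] -/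
theorem quotGradedHom_surjective : Function.Surjective (quotGradedHom 𝒜 I) :=
  Ideal.Quotient.mk_surjective

section GradedQuotientMap

variable [DecidableEq ι] [AddMonoid ι] [GradedAlgebra 𝒜] (I : HomogeneousIdeal 𝒜)

/-- **Homogeneous components pass to the quotient**: the `i`-th component of `ā` in `A ⧸ I` is the
class of the `i`-th component of `a` (`I` homogeneous). [folklore] -/
theorem decompose_quotGrading_mk (a : A) (i : ι) :
    (decompose (quotGrading 𝒜 I.toIdeal) (Ideal.Quotient.mk I.toIdeal a) i : A ⧸ I.toIdeal) =
      Ideal.Quotient.mk I.toIdeal (decompose 𝒜 a i) :=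
  ((quotGradedHom 𝒜 I.toIdeal).map_directSumDecompose (x := a) (i := i)).symm

/-- The graded pieces of the quotient are the images of those of `A` also in the sense of
`GradedRing.proj`: `proj i ā = (proj i a)‾`. [folklore] -/
theorem proj_quotGrading_mk (a : A) (i : ι) :
    GradedRing.proj (quotGrading 𝒜 I.toIdeal) i (Ideal.Quotient.mk I.toIdeal a) =
      Ideal.Quotient.mk I.toIdeal (GradedRing.proj 𝒜 i a) := by
  rw [GradedRing.proj_apply, GradedRing.proj_apply, decompose_quotGrading_mk]

end GradedQuotientMap

section Irrelevant

variable [DecidableEq ι] [AddCommMonoid ι] [PartialOrder ι] [CanonicallyOrderedAdd ι]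
  [GradedAlgebra 𝒜] (I : HomogeneousIdeal 𝒜)

/-- The irrelevant ideal of `A ⧸ I` is contained in (indeed equal to) the image of the irrelevant
ideal of `A` — the hypothesis `hf` of Mathlib's `AlgebraicGeometry.Proj.map` for the quotient map,
so that `Proj (A ⧸ I) ⟶ Proj A` is defined. [folklore] -/
theorem irrelevant_quotGrading_le_map :
    HomogeneousIdeal.irrelevant (quotGrading 𝒜 I.toIdeal) ≤
      (HomogeneousIdeal.irrelevant 𝒜).map (quotGradedHom 𝒜 I.toIdeal) := by
  rw [HomogeneousIdeal.irrelevant_le]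
  intro i hi x hx
  obtain ⟨a, ha, rfl⟩ := mem_quotGrading_iff.1 hx
  exact Ideal.mem_map_of_mem _ (HomogeneousIdeal.mem_irrelevant_of_mem 𝒜 hi ha)

end Irrelevant

end Literature.RingTheory.GradedAlgebra
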